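import Summits.CriticalPhenomena.CardyFormulaZ2.Theorems.CardyFlipRussoVoronoiHubFromSmirnovVoidConsequences

/-!
# A defective square forces a local potential defect (one-arm route, Core C1′; lead c3)

Line `moebius-exact-delaunay-dilation-ward` of crux `VoronoiHubFromSmirnov` (stmt-CriticalPhenomena-6433).
On the no-void event, a defect pair carried by the square of centre `z` (side `u`) — two black
nuclei physically in `K`, one of them in the square, on which the Euclidean window adjacency and the
pulled-back adjacency disagree — forces one of FOUR local events near the square: a near-tied navel
or a close pair of the nuclei within `2u` of `z` (tolerance `W δ² (2 r_v)³`), or a near-tied navel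
or a close pair of their TRANSPORTED images near `T z` (tolerance `W' δ² (2 Λ r_v)³`).  This is the
landed Pr1a (`potDef_of_euc_not_pull` / `potDef_of_pull_not_euc`) fed with the uniform Lemma-4.2
packages of `g` and of its inverse (`uniform_defectPackage`), the bi-Lipschitz package
(`transport_bilipschitz`), the injectivity modulus, and the no-void consequences of Core C1.
-/

noncomputable section

namespace Summit.CriticalPhenomena.CardyFormulaZ2.Cruxes.VoronoiHubFromSmirnov.MoebiusExactDelaunayDilationWard

open Set Metric
open Literature.Analysis.FunctionSpaces
open Literature.Probability.LatticeModels (IsDelaunayPair voronoiCell)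

/-! ### Localising the potential-defect events -/

/-- The witnesses of a near-tied navel lie within `ρ + 2ℓ + τ` of the centre (registered glue
sub-goal, ∀-form). -/
theorem nearTie_localize : ∀ (N : Set ℂ) (z : ℂ) (ρ ℓ τ : ℝ), NearTie N z ρ ℓ τ → NearTie (N ∩ Metric.closedBall z (ρ + 2 * ℓ + τ)) z ρ ℓ τ := by
  intro N z ρ ℓ τ h
  obtain ⟨x, p, q, a, b, hp, hq, ha, hb, h1, h2, h3, h4, h5, h6, hx, hpx, hpℓ, habx, hpa, haτ⟩ := h
  rw [mem_closedBall] at hx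
  have hℓ0 : 0 ≤ ℓ := dist_nonneg.trans hpℓ
  have hτ0 : 0 < τ := by linarith
  have hP : ∀ y : ℂ, dist y x ≤ ℓ + τ → y ∈ closedBall z (ρ + 2 * ℓ + τ) := fun y hy => by
    rw [mem_closedBall]
    linarith [dist_triangle y x z]
  exact ⟨x, p, q, a, b, ⟨hp, hP p (by linarith)⟩, ⟨hq, hP q (by rw [← hpx]; linarith)⟩,
    ⟨ha, hP a (by linarith)⟩, ⟨hb, hP b (by rw [← habx]; linarith)⟩, h1, h2, h3, h4, h5, h6,
    mem_closedBall.2 hx, hpx, hpℓ, habx, hpa, haτ⟩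

/-- The witnesses of a near-tied navel lie within `ρ + 2ℓ + τ` of the centre. -/
theorem NearTie.localize {N : Set ℂ} {z : ℂ} {ρ ℓ τ : ℝ} (h : NearTie N z ρ ℓ τ) :
    NearTie (N ∩ closedBall z (ρ + 2 * ℓ + τ)) z ρ ℓ τ :=
  nearTie_localize N z ρ ℓ τ h

/-- The witnesses of a close pair lie within `ρ + τ` of the centre. -/
theorem ClosePair.localize {N : Set ℂ} {z : ℂ} {ρ τ : ℝ} (h : ClosePair N z ρ τ) :
    ClosePair (N ∩ closedBall z (ρ + τ)) z ρ τ := by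
  obtain ⟨a, ha, b, hb, hab, haz, hd⟩ := h
  have haz' := mem_closedBall.1 haz
  refine ⟨a, ⟨ha, mem_closedBall.2 (by linarith [dist_nonneg (x := a) (y := b)])⟩,
    b, ⟨hb, mem_closedBall.2 ?_⟩, hab, haz, hd⟩
  linarith [dist_triangle b a z, dist_comm a b]

/-! ### The defect-to-local-event lemma -/

section Setting

variable {g finv : ℂ → ℂ} {V Kc : Set ℂ} {δ r_v Λ r η m₁ u s W ℓ₀ W' ℓ₀' r_g r_f : ℝ}
  {c : PointConfig ℂ × PointConfig ℂ}

/-- **A defective square forces a local potential defect.**  Hypotheses: the mesh `δ`, no-void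
radius `r_v`, square side `u ≥ 2Λ² r_v`, localisation radius `s` (configuration coordinates); the
bi-Lipschitz package of `g` (constant `Λ ≥ 1`, physical radius `r`) around the points of `Kc ⊇ V`
and its injectivity modulus `η` at physical distance `δ s`; the uniform Lemma-4.2 packages of `g`
(balls of radius `r_g`, constants `W, ℓ₀`) and of its left inverse `finv` (balls of radius `r_f`
around image points, constants `W', ℓ₀'`); the no-void event at radius `r_v`; the carrier `K ⊆ Kc`
is `m₁`-deep in `V`; and the numerical fits (all of the form "`δ ×` polylog is small").  Conclusion:
a defect pair carried by the square of centre `z = sqCentre u k` forces a near-tied navel or a close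
pair of the nuclei within `2u` of `z`, or of their transported images near `T z`. -/
theorem vc_defLoc_of_defSq (hδ : 0 < δ) (hrv : 0 < r_v) (hΛ : 1 ≤ Λ) (hVKc : V ⊆ Kc)
    {K : Set ℂ} (hKKc : K ⊆ Kc)
    (hKdeep : ∀ x ∈ K, closedBall x m₁ ⊆ V)
    -- bi-Lipschitz package of `g`
    (hup : ∀ x ∈ Kc, ∀ z ∈ closedBall x r, ∀ w ∈ closedBall x r, dist (g z) (g w) ≤ Λ * dist z w)
    (hlow : ∀ x ∈ Kc, ∀ z ∈ closedBall x r, ∀ w ∈ closedBall x r, dist z w ≤ Λ * dist (g z) (g w))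
    (hsurj : ∀ x ∈ Kc, ∀ ρ : ℝ, 0 ≤ ρ → Λ * ρ ≤ r →
      closedBall (g x) ρ ⊆ g '' closedBall x (Λ * ρ))
    (hmod : ∀ z ∈ Kc, ∀ w ∈ Kc, r / 2 ≤ dist z w → η ≤ dist (g z) (g w))
    (hmods : ∀ z ∈ Kc, ∀ w ∈ Kc, δ * s ≤ dist z w → η ≤ dist (g z) (g w))
    (hleft : ∀ x ∈ V, finv (g x) = x)
    -- Lemma 4.2 packages
    (hDg : ∀ x ∈ Kc, ∀ (ω : Set ℂ) (p q : ℂ) (ℓ : ℝ), ω ⊆ closedBall x r_g →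
      (∀ K' : Set ℂ, IsCompact K' → (ω ∩ K').Finite) → p ∈ ω → q ∈ ω → p ≠ q → 0 < ℓ → ℓ ≤ ℓ₀ →
      closedBall p (4 * ℓ) ⊆ closedBall x r_g → voronoiCell ω p ⊆ closedBall p ℓ →
      IsDelaunayPair ω p q → ¬ IsDelaunayPair (g '' ω) (g p) (g q) →
      (∃ (x' a b : ℂ), a ∈ ω ∧ b ∈ ω ∧ a ≠ b ∧ a ≠ p ∧ a ≠ q ∧ b ≠ p ∧ b ≠ q ∧
        dist p x' = dist q x' ∧ dist p x' ≤ ℓ ∧ (∀ d ∈ ω, dist p x' ≤ dist d x') ∧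
        dist a x' = dist b x' ∧ dist a x' < dist p x' + W * ℓ ^ 3) ∨
      (∃ a ∈ ω, a ≠ p ∧ a ≠ q ∧ (dist a p < W * ℓ ^ 3 ∨ dist a q < W * ℓ ^ 3)))
    (hDf : ∀ x' ∈ g '' Kc, ∀ (ω : Set ℂ) (p q : ℂ) (ℓ : ℝ), ω ⊆ closedBall x' r_f →
      (∀ K' : Set ℂ, IsCompact K' → (ω ∩ K').Finite) → p ∈ ω → q ∈ ω → p ≠ q → 0 < ℓ → ℓ ≤ ℓ₀' →
      closedBall p (4 * ℓ) ⊆ closedBall x' r_f → voronoiCell ω p ⊆ closedBall p ℓ →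
      IsDelaunayPair ω p q → ¬ IsDelaunayPair (finv '' ω) (finv p) (finv q) →
      (∃ (x'' a b : ℂ), a ∈ ω ∧ b ∈ ω ∧ a ≠ b ∧ a ≠ p ∧ a ≠ q ∧ b ≠ p ∧ b ≠ q ∧
        dist p x'' = dist q x'' ∧ dist p x'' ≤ ℓ ∧ (∀ d ∈ ω, dist p x'' ≤ dist d x'') ∧
        dist a x'' = dist b x'' ∧ dist a x'' < dist p x'' + W' * ℓ ^ 3) ∨
      (∃ a ∈ ω, a ≠ p ∧ a ≠ q ∧ (dist a p < W' * ℓ ^ 3 ∨ dist a q < W' * ℓ ^ 3)))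
    -- numerical fits
    (hs₁ : 6 * r_v ≤ s) (hs₂ : 5 * Λ ^ 3 * r_v ≤ s) (hsr : δ * s ≤ r) (hsg : δ * s ≤ r_g)
    (hsf : Λ * (δ * s) ≤ r_f) (h8g : 8 * (δ * r_v) ≤ r_g) (h8f : 8 * Λ * (δ * r_v) ≤ r_f)
    (hℓ₀ : δ * (2 * r_v) ≤ ℓ₀) (hℓ₀' : δ * (2 * Λ * r_v) ≤ ℓ₀')
    (hτ : W * δ ^ 2 * (2 * r_v) ^ 3 ≤ 2 * r_v) (hτ' : W' * δ ^ 2 * (2 * Λ * r_v) ^ 3 ≤ 2 * Λ * r_v)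
    (hη : δ * (2 * Λ * r_v) < η) (hr : 0 < r)
    (hfit : δ * (Λ ^ 2 * (4 * Λ * r_v) + r_v) ≤ r)
    (hfit' : Λ ^ 2 * (4 * Λ * r_v) + r_v ≤ m₁ / δ - r_v) (hfitu : δ * u ≤ r)
    (hρD : u + Λ * (3 * (2 * Λ * r_v) + W' * δ ^ 2 * (2 * Λ * r_v) ^ 3) ≤ 2 * u)
    (hρD' : u + 6 * r_v + W * δ ^ 2 * (2 * r_v) ^ 3 ≤ 2 * u)
    -- the no-void event and the defective square
    (hvoid : ∀ z ∈ Kc, ∃ x ∈ (c.1 : Set ℂ), dist x (z / (δ : ℂ)) < r_v) {k : ℤ × ℤ} (hupos : 0 < u)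
    (hdef : DefSq (adjEuc {b : ℂ | (δ : ℂ) * b ∈ V} c) (adjPull g V δ c) u k K δ (c.1 : Set ℂ)) :
    NearTie ((((c.1 : Set ℂ) ∪ (c.2 : Set ℂ))) ∩ closedBall (sqCentre u k) (2 * u)) (sqCentre u k)
        (u + 2 * r_v) (2 * r_v) (W * δ ^ 2 * (2 * r_v) ^ 3) ∨
      ClosePair ((((c.1 : Set ℂ) ∪ (c.2 : Set ℂ))) ∩ closedBall (sqCentre u k) (2 * u)) (sqCentre u k)
        (u + 6 * r_v) (W * δ ^ 2 * (2 * r_v) ^ 3) ∨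
      NearTie (transportMap g δ '' ((((c.1 : Set ℂ) ∪ (c.2 : Set ℂ))) ∩ closedBall (sqCentre u k) (2 * u)))
        (transportMap g δ (sqCentre u k)) (Λ * u + 2 * Λ * r_v) (2 * Λ * r_v)
        (W' * δ ^ 2 * (2 * Λ * r_v) ^ 3) ∨
      ClosePair (transportMap g δ '' ((((c.1 : Set ℂ) ∪ (c.2 : Set ℂ))) ∩ closedBall (sqCentre u k) (2 * u)))
        (transportMap g δ (sqCentre u k)) (Λ * u + 3 * (2 * Λ * r_v))
        (W' * δ ^ 2 * (2 * Λ * r_v) ^ 3) := by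
  classical
  have hδ' : (δ : ℂ) ≠ 0 := Complex.ofReal_ne_zero.2 hδ.ne'
  have hΛ0 : 0 < Λ := lt_of_lt_of_le one_pos hΛ
  have hΛ2 : (1 : ℝ) ≤ Λ ^ 2 := one_le_pow₀ hΛ
  have hΛ3 : (1 : ℝ) ≤ Λ ^ 2 * Λ := one_le_mul_of_one_le_of_one_le hΛ2 hΛ
  set T : ℂ → ℂ := transportMap g δ with hT
  set Wd : Set ℂ := {b : ℂ | (δ : ℂ) * b ∈ V} with hWd
  set N : Set ℂ := ((c.1 : Set ℂ) ∩ Wd) ∪ ((c.2 : Set ℂ) ∩ Wd) with hN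
  set z : ℂ := sqCentre u k with hz
  set τ : ℝ := W * δ ^ 2 * (2 * r_v) ^ 3 with hτdef
  set ℓ' : ℝ := 2 * Λ * r_v with hℓ'
  set τ' : ℝ := W' * δ ^ 2 * ℓ' ^ 3 with hτ'def
  have hℓ'0 : 0 < ℓ' := by positivity
  -- the two adjacencies in terms of `N`
  have hE₁iff : ∀ p q, adjEuc Wd c p q ↔ IsDelaunayPair N p q := fun p q => Iff.rfl
  have hTS : transportSet g V δ c.1 ∪ transportSet g V δ c.2 = T '' N := by
    simp only [transportSet, hN, image_union, hT, hWd]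
  have hE₂iff : ∀ p q, adjPull g V δ c p q ↔ IsDelaunayPair (T '' N) (T p) (T q) := fun p q => by
    simp only [adjPull, hTS, hT]
  -- normalise the defect pair so that `p` lies in the square
  obtain ⟨p, q, hp, hq, hpK, hqK, hpk, hdis⟩ : ∃ p q : ℂ, p ∈ (c.1 : Set ℂ) ∧ q ∈ (c.1 : Set ℂ) ∧
      (δ : ℂ) * p ∈ K ∧ (δ : ℂ) * q ∈ K ∧ sqIdx u p = k ∧
      ¬ (adjEuc Wd c p q ↔ adjPull g V δ c p q) := by
    obtain ⟨p₀, q₀, hp₀, hq₀, hp₀K, hq₀K, hsq, hne⟩ := hdef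
    rcases hsq with h | h
    · exact ⟨p₀, q₀, hp₀, hq₀, hp₀K, hq₀K, h, hne⟩
    · refine ⟨q₀, p₀, hq₀, hp₀, hq₀K, hp₀K, h, fun hiff => hne ⟨fun h1 => ?_, fun h2 => ?_⟩⟩
      · exact adjPull_symm g V δ c (hiff.1 (adjEuc_symm Wd c h1))
      · exact adjEuc_symm Wd c (hiff.2 (adjPull_symm g V δ c h2))
  have hpz : dist p z ≤ u := by rw [hz, ← hpk, dist_comm]; exact dist_sqCentre_sqIdx_le hupos p
  -- `p ≠ q`: a pair `(p, p)` is Delaunay for every nucleus set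
  have hself : ∀ (ω : Set ℂ) (x : ℂ), IsDelaunayPair ω x x := fun ω x =>
    ⟨x, 0, dist_self x, dist_self x, fun _ _ => dist_nonneg⟩
  have hpq : p ≠ q := by
    rintro rfl
    exact hdis ⟨fun _ => (hE₂iff p p).2 (hself _ _), fun _ => hself _ _⟩
  -- common facts about `p`
  have hpKc : (δ : ℂ) * p ∈ Kc := hKKc hpK
  have hqKc : (δ : ℂ) * q ∈ Kc := hKKc hqK
  have hdeep : closedBall ((δ : ℂ) * p) m₁ ⊆ V := hKdeep _ hpK
  have hm₁ : 0 ≤ m₁ := by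
    have h0 : 0 < Λ ^ 2 * (4 * Λ * r_v) + r_v := by positivity
    have h1 : (0 : ℝ) < m₁ / δ - r_v := by linarith only [h0, hfit']
    have h2 : 0 < m₁ / δ := by linarith only [h1, hrv]
    exact ((div_pos_iff_of_pos_right hδ).1 h2).le
  have hpV : (δ : ℂ) * p ∈ V := hdeep (mem_closedBall_self hm₁)
  have hqV : (δ : ℂ) * q ∈ V := hKdeep _ hqK (mem_closedBall_self hm₁)
  have hpN : p ∈ N := Or.inl ⟨hp, hpV⟩
  have hqN : q ∈ N := Or.inl ⟨hq, hqV⟩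
  have hNsub : N ⊆ (c.1 : Set ℂ) ∪ (c.2 : Set ℂ) :=
    union_subset_union inter_subset_left inter_subset_left
  have hNV : ∀ y ∈ N, (δ : ℂ) * y ∈ V := fun y hy => by
    rcases hy with ⟨-, h⟩ | ⟨-, h⟩ <;> exact h
  have hfin : (N ∩ closedBall p s).Finite := by
    refine Set.Finite.subset ((c.1.finite_inter_isCompact _ (isCompact_closedBall p s)).union
      (c.2.finite_inter_isCompact _ (isCompact_closedBall p s))) ?_
    rintro y ⟨hy, hys⟩
    rcases hy with ⟨h, -⟩ | ⟨h, -⟩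
    · exact Or.inl ⟨h, hys⟩
    · exact Or.inr ⟨h, hys⟩
  -- no void on the domain side near `p`, radius `r_v = (2 r_v)/2` within `2 · (2 r_v)`
  have hΛ3r : r_v ≤ Λ ^ 3 * r_v := by
    have := mul_le_mul_of_nonneg_left (one_le_pow₀ hΛ : (1 : ℝ) ≤ Λ ^ 3) hrv.le
    linarith only [this]
  have hΛ3pos : 0 ≤ Λ ^ 3 * r_v := by positivity
  have hfit4 : 4 * r_v ≤ m₁ / δ - r_v := by linarith only [hΛ3r, hfit', hrv]
  have hvoidσ : ∀ w : ℂ, dist w p ≤ 2 * (2 * r_v) → ∃ y ∈ N, dist y w < 2 * r_v / 2 := by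
    intro w hw
    obtain ⟨y, hy, hyw⟩ := vc_window_noVoid hδ hrv.le hVKc hvoid hdeep (by linarith only [hw, hfit4])
    exact ⟨y, Or.inl hy, by linarith only [hyw]⟩
  -- image no-void near `T p` at the two radii used
  have himvoid : ∀ ρ' : ℝ, 0 ≤ ρ' → ρ' ≤ 4 * Λ * r_v → ∀ w' : ℂ, dist w' (T p) ≤ ρ' →
      ∃ y ∈ N, dist y p ≤ Λ ^ 2 * ρ' + r_v ∧ dist (T y) w' < Λ * r_v := by
    intro ρ' hρ'0 hρ' w' hw'
    have hmul : Λ ^ 2 * ρ' ≤ Λ ^ 2 * (4 * Λ * r_v) := mul_le_mul_of_nonneg_left hρ' (by positivity)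
    have hfit₁ : δ * (Λ ^ 2 * ρ' + r_v) ≤ r := by
      have : δ * (Λ ^ 2 * ρ' + r_v) ≤ δ * (Λ ^ 2 * (4 * Λ * r_v) + r_v) :=
        mul_le_mul_of_nonneg_left (by linarith only [hmul]) hδ.le
      linarith only [this, hfit]
    have hfit₂ : Λ ^ 2 * ρ' + r_v ≤ m₁ / δ - r_v := by linarith only [hmul, hfit']
    obtain ⟨y, hy, hyp, hyw⟩ := vc_image_noVoid hδ hrv.le hΛ hVKc hvoid hdeep (hup _ hpKc)
      (hsurj _ hpKc) hρ'0 hfit₁ hfit₂ hw'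
    exact ⟨y, Or.inl hy, hyp, hyw⟩
  -- physical distances from `δ p` of the localised nuclei
  have hball_s : ∀ y : ℂ, dist y p ≤ s → (δ : ℂ) * y ∈ closedBall ((δ : ℂ) * p) r := fun y hy => by
    rw [mem_closedBall, dist_real_mul δ hδ]
    exact (mul_le_mul_of_nonneg_left hy hδ.le).trans hsr
  -- distance from `T p` to `T z`
  have hTpz : dist (T p) (T z) ≤ Λ * u := by
    have hzb : (δ : ℂ) * z ∈ closedBall ((δ : ℂ) * p) r := by
      rw [mem_closedBall, dist_real_mul δ hδ, dist_comm]
      exact (mul_le_mul_of_nonneg_left hpz hδ.le).trans hfitu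
    have hpb : (δ : ℂ) * p ∈ closedBall ((δ : ℂ) * p) r := mem_closedBall_self hr.le
    have h := hup _ hpKc _ hpb _ hzb
    rw [dist_real_mul δ hδ] at h
    rw [hT, vc_dist_transportMap hδ]
    calc δ⁻¹ * dist (g ((δ : ℂ) * p)) (g ((δ : ℂ) * z)) ≤ δ⁻¹ * (Λ * (δ * dist p z)) :=
          mul_le_mul_of_nonneg_left h (inv_nonneg.2 hδ.le)
      _ = Λ * dist p z := by field_simp
      _ ≤ Λ * u := mul_le_mul_of_nonneg_left hpz hΛ0.le
  -- CASE ANALYSIS on the direction of the defect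
  by_cases hE₁ : adjEuc Wd c p q
  · ------------------------------------------------------------------ direction 1
    have hE₂ : ¬ adjPull g V δ c p q := fun h => hdis ⟨fun _ => h, fun _ => hE₁⟩
    have hE₁' : IsDelaunayPair N p q := hE₁
    have hE₂' : ¬ IsDelaunayPair (T '' N) (T p) (T q) := fun h => hE₂ ((hE₂iff p q).2 h)
    have hMB : (fun y : ℂ => (δ : ℂ) * y) '' (N ∩ closedBall p s) ⊆ closedBall ((δ : ℂ) * p) r_g := by
      rintro _ ⟨y, ⟨-, hys⟩, rfl⟩
      rw [mem_closedBall, dist_real_mul δ hδ]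
      exact (mul_le_mul_of_nonneg_left (mem_closedBall.1 hys) hδ.le).trans hsg
    have hballg : closedBall ((δ : ℂ) * p) (4 * (δ * (2 * r_v))) ⊆ closedBall ((δ : ℂ) * p) r_g :=
      closedBall_subset_closedBall (by linarith only [h8g])
    have hvoid' : ∀ w' : ℂ, dist w' (T p) ≤ 2 * (Λ * r_v) →
        ∃ y ∈ N, dist y p ≤ s ∧ dist (T y) w' < Λ * r_v := by
      intro w' hw'
      have hΛrv : 0 ≤ Λ * r_v := by positivity
      obtain ⟨y, hy, hyp, hyw⟩ := himvoid (2 * Λ * r_v) (by positivity) (by linarith only [hΛrv]) w'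
        (by linarith only [hw'])
      refine ⟨y, hy, hyp.trans ?_, hyw⟩
      linarith only [hΛ3r, hs₂, hΛ3pos]
    have hfar' : ∀ y ∈ N, s < dist y p → 2 * (Λ * r_v) < dist (T y) (T p) := by
      intro y hy hys
      have hyKc : (δ : ℂ) * y ∈ Kc := hVKc (hNV y hy)
      have hd : δ * s ≤ dist ((δ : ℂ) * y) ((δ : ℂ) * p) := by
        rw [dist_real_mul δ hδ]; exact mul_le_mul_of_nonneg_left hys.le hδ.le
      have hηle := hmods _ hyKc _ hpKc hd
      rw [hT, vc_dist_transportMap hδ]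
      have : δ⁻¹ * η ≤ δ⁻¹ * dist (g ((δ : ℂ) * y)) (g ((δ : ℂ) * p)) :=
        mul_le_mul_of_nonneg_left hηle (inv_nonneg.2 hδ.le)
      have h2 : 2 * (Λ * r_v) < δ⁻¹ * η := by
        rw [lt_inv_mul_iff₀ hδ]; linarith only [hη]
      linarith only [this, h2]
    have hres := potDef_of_euc_not_pull g (closedBall ((δ : ℂ) * p) r_g) W ℓ₀ (hDg _ hpKc) hδ
      (by positivity : (0 : ℝ) < 2 * r_v) (by positivity : (0 : ℝ) < Λ * r_v) (by linarith only [hs₁]) hℓ₀ hτ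
      hpN hqN hpq hfin hMB hballg hvoidσ hvoid' hfar' hE₁' hE₂'
    -- read the result near the square centre
    rcases hres with h | h
    · left
      have hloc := h.localize
      refine hloc.mono ?_ ?_ le_rfl le_rfl
      · rintro y ⟨hy, hyb⟩
        refine ⟨hNsub hy, mem_closedBall.2 ?_⟩
        have := mem_closedBall.1 hyb
        linarith only [this, hpz, hρD', dist_triangle y p z]
      · linarith only [hpz]
    · right; left
      have hloc := h.localize
      refine hloc.mono ?_ ?_ le_rfl
      · rintro y ⟨hy, hyb⟩
        refine ⟨hNsub hy, mem_closedBall.2 ?_⟩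
        have := mem_closedBall.1 hyb
        linarith only [this, hpz, hρD', dist_triangle y p z]
      · linarith only [hpz]
  · ------------------------------------------------------------------ direction 2
    have hE₂ : adjPull g V δ c p q := by
      by_contra h
      exact hdis ⟨fun h1 => absurd h1 hE₁, fun h2 => absurd h2 h⟩
    have hE₁' : ¬ IsDelaunayPair N p q := hE₁
    have hE₂' : IsDelaunayPair (T '' N) (T p) (T q) := (hE₂iff p q).1 hE₂
    have hMB' : ∀ y ∈ N, dist y p ≤ s → g ((δ : ℂ) * y) ∈ closedBall (g ((δ : ℂ) * p)) r_f := by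
      intro y _ hys
      have h := hup _ hpKc _ (hball_s y hys) _ (mem_closedBall_self hr.le)
      rw [dist_real_mul δ hδ] at h
      rw [mem_closedBall]
      calc dist (g ((δ : ℂ) * y)) (g ((δ : ℂ) * p)) ≤ Λ * (δ * dist y p) := h
        _ ≤ Λ * (δ * s) := by gcongr
        _ ≤ r_f := hsf
    have hleft' : ∀ y ∈ N, dist y p ≤ s → finv (g ((δ : ℂ) * y)) = (δ : ℂ) * y :=
      fun y hy _ => hleft _ (hNV y hy)
    have hballf : closedBall ((δ : ℂ) * T p) (4 * (δ * ℓ')) ⊆ closedBall (g ((δ : ℂ) * p)) r_f := by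
      rw [hT, vc_mul_transportMap (g := g) hδ]
      exact closedBall_subset_closedBall (by rw [hℓ']; linarith only [h8f])
    have hvoid'' : ∀ w' : ℂ, dist w' (T p) ≤ 2 * ℓ' →
        ∃ y ∈ N, dist y p ≤ s ∧ dist (T y) w' < ℓ' / 2 := by
      intro w' hw'
      obtain ⟨y, hy, hyp, hyw⟩ := himvoid (4 * Λ * r_v) (by positivity) le_rfl w'
        (by rw [hℓ'] at hw'; linarith only [hw'])
      refine ⟨y, hy, hyp.trans ?_, by rw [hℓ']; linarith only [hyw]⟩
      linarith only [hΛ3r, hs₂, hΛ3pos]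
    have hqs : dist q p ≤ s := by
      have hfit₂ : δ * (Λ ^ 2 * (2 * Λ * r_v) + r_v) ≤ r := by
        have : δ * (Λ ^ 2 * (2 * Λ * r_v) + r_v) ≤ δ * (Λ ^ 2 * (4 * Λ * r_v) + r_v) :=
          mul_le_mul_of_nonneg_left (by linarith only [hΛ3pos]) hδ.le
        linarith only [this, hfit]
      have hfit₂' : Λ ^ 2 * (2 * Λ * r_v) + r_v ≤ m₁ / δ - r_v := by linarith only [hfit', hΛ3pos]
      have h := vc_dist_le_of_adjPull hδ hrv hΛ hVKc hvoid hpKc hqKc hdeep (hup _ hpKc) (hlow _ hpKc)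
        (hsurj _ hpKc) hmod hη (by linarith only [hr]) hfit₂ hfit₂' hE₂
      refine h.trans ?_
      have hΛ23 : Λ ^ 2 * r_v ≤ Λ ^ 3 * r_v := by
        have := mul_le_mul_of_nonneg_left hΛ (by positivity : (0 : ℝ) ≤ Λ ^ 2 * r_v)
        linarith only [this]
      linarith only [hΛ23, hs₂, hΛ3pos]
    have hres := potDef_of_pull_not_euc g finv (closedBall (g ((δ : ℂ) * p)) r_f) W' ℓ₀'
      (hDf _ ⟨_, hpKc, rfl⟩) hδ (by positivity : (0 : ℝ) < 2 * r_v) hℓ'0 (by linarith only [hs₁])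
      (by rw [hℓ']; exact hℓ₀') (by rw [hℓ']; exact hτ') hpN hqN hpq hfin hMB' hleft' hballf hvoidσ
      hvoid'' hqs hE₁' hE₂'
    -- localise around `T p`, pull back by the lower Lipschitz bound, re-centre at `T z`
    have hpull : ∀ ϱ : ℝ, ϱ ≤ 3 * ℓ' + τ' →
        T '' (N ∩ closedBall p s) ∩ closedBall (T p) ϱ ⊆
          T '' ((((c.1 : Set ℂ) ∪ (c.2 : Set ℂ))) ∩ closedBall z (2 * u)) := by
      intro ϱ hϱ
      rintro _ ⟨⟨y, ⟨hy, hys⟩, rfl⟩, hyb⟩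
      refine ⟨y, ⟨hNsub hy, mem_closedBall.2 ?_⟩, rfl⟩
      have hL := hlow _ hpKc _ (hball_s y (mem_closedBall.1 hys)) _ (mem_closedBall_self hr.le)
      rw [dist_real_mul δ hδ] at hL
      have hTd : dist (g ((δ : ℂ) * y)) (g ((δ : ℂ) * p)) = δ * dist (T y) (T p) := by
        rw [hT, vc_dist_transportMap hδ, ← mul_assoc, mul_inv_cancel₀ hδ.ne', one_mul]
      rw [hTd] at hL
      have hyb' := mem_closedBall.1 hyb
      have hyb'' : Λ * (δ * dist (T y) (T p)) ≤ Λ * (δ * ϱ) :=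
        mul_le_mul_of_nonneg_left (mul_le_mul_of_nonneg_left hyb' hδ.le) hΛ0.le
      have h1 : δ * dist y p ≤ δ * (Λ * ϱ) := by linarith only [hL, hyb'']
      have h2 : dist y p ≤ Λ * ϱ := le_of_mul_le_mul_left h1 hδ
      have h3 : Λ * ϱ ≤ Λ * (3 * ℓ' + τ') := mul_le_mul_of_nonneg_left hϱ hΛ0.le
      have h4 : u + Λ * (3 * ℓ' + τ') ≤ 2 * u := hρD
      linarith only [h2, h3, h4, hpz, dist_triangle y p z]
    rcases hres with h | h
    · right; right; left
      have hloc := h.localize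
      have hsub := hpull (ℓ' + 2 * ℓ' + τ') (by linarith only)
      exact hloc.mono hsub (show ℓ' + dist (T p) (T z) ≤ Λ * u + ℓ' by linarith only [hTpz])
        le_rfl le_rfl
    · right; right; right
      have hloc := h.localize
      have hsub := hpull (3 * ℓ' + τ') le_rfl
      exact hloc.mono hsub (show 3 * ℓ' + dist (T p) (T z) ≤ Λ * u + 3 * ℓ' by
        linarith only [hTpz]) le_rfl

end Setting

end Summit.CriticalPhenomena.CardyFormulaZ2.Cruxes.VoronoiHubFromSmirnov.MoebiusExactDelaunayDilationWard

end
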